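import Mathlib
import Summits.Ventures.PercRepro2.Defs
import Summits.Ventures.PercRepro2.Graph
import Summits.Ventures.PercRepro2.OneColourSwitch
import Summits.Ventures.PercRepro2.RegionHubSign
import Summits.Ventures.PercRepro2.SideSwitch
import Summits.Ventures.PercRepro2.TermSwitchDefs
import Summits.Ventures.PercRepro2.TermSwitchFibre
import Summits.Ventures.PercRepro2.TermSwitchCompsFibre
import Summits.Ventures.PercRepro2.TermSwitchM9
import Summits.Ventures.PercRepro2.M9LoopTransfer
import Summits.Ventures.PercRepro2.M9PendantSeries
import Summits.Ventures.PercRepro2.M9NoPocketDefs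
import Summits.Ventures.PercRepro2.M9YSliceDefs
import Summits.Ventures.PercRepro2.M9DegreeThreeTransfer

/-!
# The degree-three identity for the single-`d` sum (blind cell PercRepro2, p3 g26,
2026-08-28; `proofs/P3-YSLICE.md` §1–2)

Let the non-mark `d` carry exactly three non-loop edges `e₁, e₂, e₃` with `ends eᵢ = {d, xᵢ}`
(the `xᵢ` arbitrary, repetitions allowed).  Split `Σ_{Sep ∧ DOne(d)} σ_pq · σ_rs` by the colour
pattern on `(e₁, e₂, e₃)`: the two constant patterns are the `Y`-slice (`ySlice`, twice by the
colour flip), and a pattern `(c, c, c̄)` makes `d` act, in colour `c`, as the edge `{xᵢ, xⱼ}`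
between the ends of its two `c`-edges and, in colour `c̄`, as a pendant: for `a, b ≠ d` the
connections are those of `G_ij` — `eᵢ` re-attached as `{xᵢ, xⱼ}`, the other two edges looped
(`conn_three_iff` of `M9DegreeThreeTransfer`, whence the kernel transfer `dker_eq_zker_three`).
Hence

  `dSignSum = 2 · ySlice + Σ_{i<j} pairSum_ij`,   `4 · pairSum_ij = dzeroSignSumH (G_ij)`

(`dSignSum_eq_three`, `four_mul_pairSum`), where `pairSum_ij` is the `DZero` sum of `G_ij` over
the two patterns `(Y, Y, W)`, `(W, W, Y)` on `(eᵢ, eⱼ, e_k)` and the factor `4` counts the free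
colours of the two loops.  With the terminal-set theorem `dzeroSignSumH_nonpos` this gives the
**degree-three class**: `dSignSum ≤ 0` whenever `ySlice ≤ 0`
(`dSignSum_nonpos_of_degree_three_of_ySlice`).  Own work; std axioms.
-/

namespace Summit.Ventures.PercRepro2

namespace NoPocket

open Finset Classical OneColourSwitch SideSwitch TermSwitch M9Reduce

variable {V : Type*} {E : Type*}
variable [Fintype V] [DecidableEq V] [Fintype E] [DecidableEq E]

section Sums

variable {ends : E → Sym2 V}

/-- The pattern sum: the kernel `F` summed over the colourings with the prescribed colours on
`e₁, e₂, e₃`. -/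
noncomputable def patSum (F : Config E → ℤ) (e₁ e₂ e₃ : E) (b₁ b₂ b₃ : Bool) : ℤ :=
  ∑ ω : Config E, if ω e₁ = b₁ ∧ ω e₂ = b₂ ∧ ω e₃ = b₃ then F ω else 0

omit [Fintype V] [DecidableEq V] in
/-- A sum splits into its eight pattern sums. -/
lemma sum_eq_sum_patSum (F : Config E → ℤ) (e₁ e₂ e₃ : E) :
    ∑ ω : Config E, F ω =
      patSum F e₁ e₂ e₃ true true true + patSum F e₁ e₂ e₃ false false false +
      (patSum F e₁ e₂ e₃ true true false + patSum F e₁ e₂ e₃ false false true) +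
      (patSum F e₁ e₂ e₃ true false true + patSum F e₁ e₂ e₃ false true false) +
      (patSum F e₁ e₂ e₃ false true true + patSum F e₁ e₂ e₃ true false false) := by
  unfold patSum
  simp only [← Finset.sum_add_distrib]
  refine Finset.sum_congr rfl (fun ω _ => ?_)
  cases h1 : ω e₁ <;> cases h2 : ω e₂ <;> cases h3 : ω e₃ <;> simp

omit [Fintype V] [DecidableEq V] in
/-- Flipping the colour of a loop-like edge (one the kernel ignores) exchanges two pattern sums. -/
lemma patSum_flip₂ {F : Config E → ℤ} {e₁ e₂ e₃ : E} (h12 : e₁ ≠ e₂) (h23 : e₂ ≠ e₃)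
    (hF : ∀ ω b, F (Function.update ω e₂ b) = F ω) (b₁ b₂ b₃ : Bool) :
    patSum F e₁ e₂ e₃ b₁ b₂ b₃ = patSum F e₁ e₂ e₃ b₁ (!b₂) b₃ := by
  unfold patSum
  refine Fintype.sum_equiv (flipE e₂) _ _ (fun ω => ?_)
  simp only [flipE_apply, Function.update_self, Function.update_of_ne h12,
    Function.update_of_ne h23.symm, hF]
  have : ((!ω e₂) = !b₂) ↔ (ω e₂ = b₂) := by cases ω e₂ <;> cases b₂ <;> simp
  simp only [this]

omit [Fintype V] [DecidableEq V] in
/-- The same for the third edge. -/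
lemma patSum_flip₃ {F : Config E → ℤ} {e₁ e₂ e₃ : E} (h13 : e₁ ≠ e₃) (h23 : e₂ ≠ e₃)
    (hF : ∀ ω b, F (Function.update ω e₃ b) = F ω) (b₁ b₂ b₃ : Bool) :
    patSum F e₁ e₂ e₃ b₁ b₂ b₃ = patSum F e₁ e₂ e₃ b₁ b₂ (!b₃) := by
  unfold patSum
  refine Fintype.sum_equiv (flipE e₃) _ _ (fun ω => ?_)
  simp only [flipE_apply, Function.update_self, Function.update_of_ne h13,
    Function.update_of_ne h23, hF]
  have : ((!ω e₃) = !b₃) ↔ (ω e₃ = b₃) := by cases ω e₃ <;> cases b₃ <;> simp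
  simp only [this]

omit [Fintype V] [DecidableEq V] in
/-- The colour flip exchanges a pattern sum with its complementary pattern, for a flip-invariant
kernel. -/
lemma patSum_compl {F : Config E → ℤ} (hF : ∀ ω, F (OneColourSwitch.compl ω) = F ω)
    (e₁ e₂ e₃ : E) (b₁ b₂ b₃ : Bool) :
    patSum F e₁ e₂ e₃ b₁ b₂ b₃ = patSum F e₁ e₂ e₃ (!b₁) (!b₂) (!b₃) := by
  unfold patSum
  refine Fintype.sum_equiv complPerm _ _ (fun ω => ?_)
  simp only [complPerm, Function.Involutive.coe_toPerm, hF]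
  have h : ∀ x b : Bool, ((!x) = !b) ↔ (x = b) := by intro x b; cases x <;> cases b <;> simp
  simp only [OneColourSwitch.compl, h]

end Sums

section Identity

variable {ends : E → Sym2 V}

/-- The pair sum of `G_12`: its `DZero` kernel over the patterns `(Y, Y, W)` and `(W, W, Y)`. -/
noncomputable def pairSum (ends : E → Sym2 V) (p q r s : V) (e₁ e₂ e₃ : E) (d x₁ x₂ : V) : ℤ :=
  patSum (zker (endsPair ends e₁ e₂ e₃ d x₁ x₂) p q r s) e₁ e₂ e₃ true true false +
    patSum (zker (endsPair ends e₁ e₂ e₃ d x₁ x₂) p q r s) e₁ e₂ e₃ false false true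

omit [Fintype V] [DecidableEq V] in
/-- **Four times the pair sum is the `DZero` sum of `G_12`** (the two loops are free). -/
lemma four_mul_pairSum (p q r s : V) {e₁ e₂ e₃ : E} (h12 : e₁ ≠ e₂) (h13 : e₁ ≠ e₃)
    (h23 : e₂ ≠ e₃) (d x₁ x₂ : V) :
    4 * pairSum ends p q r s e₁ e₂ e₃ d x₁ x₂ =
      dzeroSignSumH (endsPair ends e₁ e₂ e₃ d x₁ x₂) p q r s ({r, s} : Set V) := by
  have hl₂ : (endsPair ends e₁ e₂ e₃ d x₁ x₂ e₂).IsDiag := by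
    simp [endsPair, Function.update_of_ne h23]
  have hl₃ : (endsPair ends e₁ e₂ e₃ d x₁ x₂ e₃).IsDiag := by simp [endsPair]
  have hF₂ : ∀ ω b, zker (endsPair ends e₁ e₂ e₃ d x₁ x₂) p q r s (Function.update ω e₂ b) =
      zker (endsPair ends e₁ e₂ e₃ d x₁ x₂) p q r s ω := fun ω b => zker_update_loop hl₂ p q r s ω b
  have hF₃ : ∀ ω b, zker (endsPair ends e₁ e₂ e₃ d x₁ x₂) p q r s (Function.update ω e₃ b) =
      zker (endsPair ends e₁ e₂ e₃ d x₁ x₂) p q r s ω := fun ω b => zker_update_loop hl₃ p q r s ω b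
  rw [dzeroSignSumH_eq_sum_zker, sum_eq_sum_patSum _ e₁ e₂ e₃]
  unfold pairSum
  have f2 := patSum_flip₂ h12 h23 hF₂
  have f3 := patSum_flip₃ h13 h23 hF₃
  -- every pattern with `e₁ = Y` equals `(Y, Y, W)`, every pattern with `e₁ = W` equals `(W, W, Y)`
  have a1 : patSum (zker (endsPair ends e₁ e₂ e₃ d x₁ x₂) p q r s) e₁ e₂ e₃ true true true =
      patSum (zker (endsPair ends e₁ e₂ e₃ d x₁ x₂) p q r s) e₁ e₂ e₃ true true false := f3 _ _ _
  have a2 : patSum (zker (endsPair ends e₁ e₂ e₃ d x₁ x₂) p q r s) e₁ e₂ e₃ true false true =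
      patSum (zker (endsPair ends e₁ e₂ e₃ d x₁ x₂) p q r s) e₁ e₂ e₃ true true false := by
    rw [f2 _ _ _, f3 _ _ _]; rfl
  have a3 : patSum (zker (endsPair ends e₁ e₂ e₃ d x₁ x₂) p q r s) e₁ e₂ e₃ true false false =
      patSum (zker (endsPair ends e₁ e₂ e₃ d x₁ x₂) p q r s) e₁ e₂ e₃ true true false := by
    rw [f2 _ _ _]; rfl
  have b1 : patSum (zker (endsPair ends e₁ e₂ e₃ d x₁ x₂) p q r s) e₁ e₂ e₃ false false false =
      patSum (zker (endsPair ends e₁ e₂ e₃ d x₁ x₂) p q r s) e₁ e₂ e₃ false false true := f3 _ _ _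
  have b2 : patSum (zker (endsPair ends e₁ e₂ e₃ d x₁ x₂) p q r s) e₁ e₂ e₃ false true false =
      patSum (zker (endsPair ends e₁ e₂ e₃ d x₁ x₂) p q r s) e₁ e₂ e₃ false false true := by
    rw [f2 _ _ _, f3 _ _ _]; rfl
  have b3 : patSum (zker (endsPair ends e₁ e₂ e₃ d x₁ x₂) p q r s) e₁ e₂ e₃ false true true =
      patSum (zker (endsPair ends e₁ e₂ e₃ d x₁ x₂) p q r s) e₁ e₂ e₃ false false true := by
    rw [f2 _ _ _]; rfl
  rw [a1, a2, a3, b1, b2, b3]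
  ring

omit [Fintype V] [DecidableEq V] in
/-- **The degree-three identity**: if the non-loop edges at the non-mark `d` are exactly
`e₁, e₂, e₃` with `ends eᵢ = {d, xᵢ}`, then
`dSignSum = 2 · ySlice + pairSum₁₂ + pairSum₁₃ + pairSum₂₃`. -/
theorem dSignSum_eq_three {p q r s : V} {e₁ e₂ e₃ : E} {d x₁ x₂ x₃ : V}
    (h12 : e₁ ≠ e₂) (h13 : e₁ ≠ e₃) (h23 : e₂ ≠ e₃)
    (hd : ∀ e, d ∈ ends e → ¬ (ends e).IsDiag → e = e₁ ∨ e = e₂ ∨ e = e₃)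
    (h₁ : ends e₁ = s(d, x₁)) (h₂ : ends e₂ = s(d, x₂)) (h₃ : ends e₃ = s(d, x₃))
    (hx₁ : x₁ ≠ d) (hx₂ : x₂ ≠ d) (hx₃ : x₃ ≠ d)
    (hp : p ≠ d) (hq : q ≠ d) (hr : r ≠ d) (hs : s ≠ d) :
    dSignSum ends p q r s d = 2 * ySlice ends p q r s d +
      pairSum ends p q r s e₁ e₂ e₃ d x₁ x₂ + pairSum ends p q r s e₁ e₃ e₂ d x₁ x₃ +
      pairSum ends p q r s e₂ e₃ e₁ d x₂ x₃ := by
  rw [dSignSum_eq_sum_dker, sum_eq_sum_patSum _ e₁ e₂ e₃]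
  -- the constant patterns are the `Y`-slice
  have hstar : ∀ ω : Config E, StarY ends d ω ↔ (ω e₁ = true ∧ ω e₂ = true ∧ ω e₃ = true) := by
    intro ω
    constructor
    · intro h
      refine ⟨h e₁ (by rw [h₁]; exact Sym2.mem_mk_left _ _) ?_,
        h e₂ (by rw [h₂]; exact Sym2.mem_mk_left _ _) ?_,
        h e₃ (by rw [h₃]; exact Sym2.mem_mk_left _ _) ?_⟩
      · rw [h₁, Sym2.mk_isDiag_iff]; exact fun h => hx₁ h.symm
      · rw [h₂, Sym2.mk_isDiag_iff]; exact fun h => hx₂ h.symm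
      · rw [h₃, Sym2.mk_isDiag_iff]; exact fun h => hx₃ h.symm
    · rintro ⟨c1, c2, c3⟩ e hde hnd
      rcases hd e hde hnd with rfl | rfl | rfl
      · exact c1
      · exact c2
      · exact c3
  have hY : patSum (dker ends p q r s d) e₁ e₂ e₃ true true true = ySlice ends p q r s d := by
    unfold patSum ySlice dker
    refine Finset.sum_congr rfl (fun ω _ => ?_)
    rw [if_congr (hstar ω).symm rfl rfl]
    by_cases h : sep2 ends p q r s ω ∧ DOne ends r s d ω
    · by_cases hS : StarY ends d ω
      · rw [if_pos hS, if_pos h, if_pos ⟨h.1, h.2, hS⟩]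
      · rw [if_neg hS, if_neg (fun h' => hS h'.2.2)]
    · by_cases hS : StarY ends d ω
      · rw [if_pos hS, if_neg h, if_neg (fun h' => h ⟨h'.1, h'.2.1⟩)]
      · rw [if_neg hS, if_neg (fun h' => hS h'.2.2)]
  have hW : patSum (dker ends p q r s d) e₁ e₂ e₃ false false false =
      patSum (dker ends p q r s d) e₁ e₂ e₃ true true true :=
    patSum_compl (dker_compl p q r s d) e₁ e₂ e₃ false false false
  -- the mixed patterns transfer to the `DZero` kernels of the `G_ij`
  have hmix : ∀ (f₁ f₂ f₃ : E) (y₁ y₂ y₃ : V), f₁ ≠ f₂ → f₁ ≠ f₃ → f₂ ≠ f₃ →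
      (∀ e, d ∈ ends e → ¬ (ends e).IsDiag → e = f₁ ∨ e = f₂ ∨ e = f₃) →
      ends f₁ = s(d, y₁) → ends f₂ = s(d, y₂) → ends f₃ = s(d, y₃) →
      y₁ ≠ d → y₂ ≠ d → ∀ c : Bool,
      patSum (dker ends p q r s d) f₁ f₂ f₃ c c (!c) =
        patSum (zker (endsPair ends f₁ f₂ f₃ d y₁ y₂) p q r s) f₁ f₂ f₃ c c (!c) := by
    intro f₁ f₂ f₃ y₁ y₂ y₃ g12 g13 g23 gd g₁ g₂ g₃ gy₁ gy₂ c
    unfold patSum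
    refine Finset.sum_congr rfl (fun ω _ => ?_)
    by_cases h : ω f₁ = c ∧ ω f₂ = c ∧ ω f₃ = !c
    · rw [if_pos h, if_pos h]
      exact dker_eq_zker_three g12 g13 g23 gd g₁ g₂ g₃ gy₁ gy₂ hp hq hr hs
        (by rw [h.1, h.2.1]) (by rw [h.2.2, h.1])
    · rw [if_neg h, if_neg h]
  have hd' : ∀ e, d ∈ ends e → ¬ (ends e).IsDiag → e = e₁ ∨ e = e₃ ∨ e = e₂ := by
    intro e hde hnd
    rcases hd e hde hnd with h | h | h
    · exact Or.inl h
    · exact Or.inr (Or.inr h)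
    · exact Or.inr (Or.inl h)
  have hd'' : ∀ e, d ∈ ends e → ¬ (ends e).IsDiag → e = e₂ ∨ e = e₃ ∨ e = e₁ := by
    intro e hde hnd
    rcases hd e hde hnd with h | h | h
    · exact Or.inr (Or.inr h)
    · exact Or.inl h
    · exact Or.inr (Or.inl h)
  -- reorder the pattern sums of the other two pairs
  have hperm13 : ∀ b₁ b₂ b₃, patSum (dker ends p q r s d) e₁ e₂ e₃ b₁ b₂ b₃ =
      patSum (dker ends p q r s d) e₁ e₃ e₂ b₁ b₃ b₂ := by
    intro b₁ b₂ b₃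
    unfold patSum
    refine Finset.sum_congr rfl (fun ω _ => ?_)
    rw [if_congr (show (ω e₁ = b₁ ∧ ω e₂ = b₂ ∧ ω e₃ = b₃) ↔ (ω e₁ = b₁ ∧ ω e₃ = b₃ ∧ ω e₂ = b₂)
      from ⟨fun ⟨h1, h2, h3⟩ => ⟨h1, h3, h2⟩, fun ⟨h1, h3, h2⟩ => ⟨h1, h2, h3⟩⟩) rfl rfl]
  have hperm23 : ∀ b₁ b₂ b₃, patSum (dker ends p q r s d) e₁ e₂ e₃ b₁ b₂ b₃ =
      patSum (dker ends p q r s d) e₂ e₃ e₁ b₂ b₃ b₁ := by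
    intro b₁ b₂ b₃
    unfold patSum
    refine Finset.sum_congr rfl (fun ω _ => ?_)
    rw [if_congr (show (ω e₁ = b₁ ∧ ω e₂ = b₂ ∧ ω e₃ = b₃) ↔ (ω e₂ = b₂ ∧ ω e₃ = b₃ ∧ ω e₁ = b₁)
      from ⟨fun ⟨h1, h2, h3⟩ => ⟨h2, h3, h1⟩, fun ⟨h2, h3, h1⟩ => ⟨h1, h2, h3⟩⟩) rfl rfl]
  have m12 := hmix e₁ e₂ e₃ x₁ x₂ x₃ h12 h13 h23 hd h₁ h₂ h₃ hx₁ hx₂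
  have m13 := hmix e₁ e₃ e₂ x₁ x₃ x₂ h13 h12 h23.symm hd' h₁ h₃ h₂ hx₁ hx₃
  have m23 := hmix e₂ e₃ e₁ x₂ x₃ x₁ h23 h12.symm h13.symm hd'' h₂ h₃ h₁ hx₂ hx₃
  have m12t := m12 true
  have m12f := m12 false
  have m13t := m13 true
  have m13f := m13 false
  have m23t := m23 true
  have m23f := m23 false
  simp only [Bool.not_true, Bool.not_false] at m12t m12f m13t m13f m23t m23f
  rw [hW, hY, hperm13 true false true, hperm13 false true false, hperm23 false true true,
    hperm23 true false false, m12t, m12f, m13t, m13f, m23t, m23f]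
  unfold pairSum
  ring

/-- **The degree-three class, modulo the `Y`-slice**: a non-mark `d` with exactly three
non-loop edges has `dSignSum ≤ 0` as soon as its `Y`-slice is `≤ 0`. -/
theorem dSignSum_nonpos_of_degree_three_of_ySlice {p q r s : V} {e₁ e₂ e₃ : E}
    {d x₁ x₂ x₃ : V} (h12 : e₁ ≠ e₂) (h13 : e₁ ≠ e₃) (h23 : e₂ ≠ e₃)
    (hd : ∀ e, d ∈ ends e → ¬ (ends e).IsDiag → e = e₁ ∨ e = e₂ ∨ e = e₃)
    (h₁ : ends e₁ = s(d, x₁)) (h₂ : ends e₂ = s(d, x₂)) (h₃ : ends e₃ = s(d, x₃))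
    (hx₁ : x₁ ≠ d) (hx₂ : x₂ ≠ d) (hx₃ : x₃ ≠ d)
    (hp : p ≠ d) (hq : q ≠ d) (hr : r ≠ d) (hs : s ≠ d)
    (hY : ySlice ends p q r s d ≤ 0) : dSignSum ends p q r s d ≤ 0 := by
  rw [dSignSum_eq_three h12 h13 h23 hd h₁ h₂ h₃ hx₁ hx₂ hx₃ hp hq hr hs]
  have k12 : 4 * pairSum ends p q r s e₁ e₂ e₃ d x₁ x₂ ≤ 0 := by
    rw [four_mul_pairSum p q r s h12 h13 h23]
    exact dzeroSignSumH_nonpos p q s (Set.mem_insert r _)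
  have k13 : 4 * pairSum ends p q r s e₁ e₃ e₂ d x₁ x₃ ≤ 0 := by
    rw [four_mul_pairSum p q r s h13 h12 h23.symm]
    exact dzeroSignSumH_nonpos p q s (Set.mem_insert r _)
  have k23 : 4 * pairSum ends p q r s e₂ e₃ e₁ d x₂ x₃ ≤ 0 := by
    rw [four_mul_pairSum p q r s h23 h12.symm h13.symm]
    exact dzeroSignSumH_nonpos p q s (Set.mem_insert r _)
  linarith

end Identity

end NoPocket

end Summit.Ventures.PercRepro2
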